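import Summits.QuantumFields.BalabanUV.Beta.GAN24.FaceWordLeftExposure
import Summits.QuantumFields.BalabanUV.Beta.GAN24.CombChargeAntisymPairForm

/-!
# `BalabanUV.Beta.GAN24.FacePairingPairForm` — binder row G-an2-4 ∕ (CONV-C), W-slot (α-0), ROW (C)sym AT LEVELS `≥ 1` (the OWNER's two-index
# tower `PairFormPeriodTower.pairFormLS_tower₂`, RULING R-gan24p1-g40-1, rows T6-STEP): **THE TWO EXCHANGE ∕ CONTACT FACE WORDS AT ANY PERIOD ARE AN
# ENTRYWISE ANTISYMMETRIC-PAIR FORM, GIVEN THE BOND–LEG ANTISYMMETRY OF THE FULL FACE CURRENTS** — Part 44 of `GAN24/FourFaceGaugeSectors`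
# (G-an2-4 CRUX TEAM (2), leaf prover `b2b-balaban-gan24-formalise-leaf-02`, gen 69; journal [LEAF02-G69-ONLINE] INTENT 1)

NOT IN PRINT; OUR BOOKKEEPING ([folklore] lattice-sum Fubini, re-indexing and sign bookkeeping BY NAME over Part 42 `PairingCellTransfer` (cell transfer,
face masks, `nested_eq_facePairing`), Part 44a `FaceWordLeftExposure` (the left exposure), an2's `ExpKernelCalculus.biLoc_comp_biLoc ∕ comp_shiftK` and road-P2
F9 `CombChargeAntisymPairForm.pairFormLS_of_pairForm`; 0 `def`, 0 cited fact, 0 `def … : Prop`, 0 sorry).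
HONEST FRAMING (cell contract, verbatim): «discharging `BetaPertH` makes Bałaban's UV stability UNCONDITIONAL — a real constructive-QFT result; it is NOT the
continuum limit and NOT the Clay problem.»  HONEST DEPENDENCY (verbatim): «continuum YM on T⁴ ⇐ BetaPertH ∧ nine spine estimates (0/9 proved); BetaPertH ⇐
(D1) ∧ (D4) ∧ CAP+tail; G-an2-4 gates asym, D1 and NE2/3/4.»

WHY.  After road-P2 g50's transport rows (`FaceReadTransportStep.faceRead_lin4_coDress`, `CombChargeTowerStepDeepRows.towerStepDeep_of_forcingPairForm`,
`CombChargeTowerStepZero.towerStepZero_pin_of_forcingPairForm`) the step displays `hstep (m, i)` of the OWNER's tower cost ONE supplier statement per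
level `i` and face period `P = Lc^m`: «the leg-and-bond symmetrised face read `LS(FFsym_P(b̃_i))` of the E-frame forcing is a pair form».  Opened into words
(leaf-06 K6c `FourFaceSourceWords.fourFace_dressedSource_inl_inl` with leaf-04's sector zeros and the bond push K1a `DressedVertexFaceBondSum`), and with the
response words dying under `LS` (Part 41 `RespWordsLegAntisymm`, leaf-04 F6), what is left at every `(i, P)` are the TWO EXCHANGE (= my g67's «contact») FACE
WORDS of the fine tables `S = S̃_i`, `G = G̃_i` with all four slots on the exit faces of ONE period `N` (`= Lc·P` after the transport), the first bond on the cell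
`box N`:
  `EE₁(μ,ν;α,β) := Σ_{rr∈box N} Σ'_t χ(rr_μ)·χ(t_ν)·Σ'_{(y,w)} χ(y_α)·χ(w_β)·((S μ rr ∘ G) ∘ S ν t)(y,w)(inl α)(inl β)`,
  `EE₂(μ,ν;α,β) :=` the same with the triple word `(S ν t ∘ G) ∘ S μ rr`,   `χ(n) := [n % N = N − 1]`
(Part 43's `sum_box_tsum_facePairing_swap` literal at period `N`).  THIS FILE: for ANY period `N ≥ 1`, ANY local stencil family `S` (`LocStencil S Cs δ`) and
decaying kernel `G` (`Decays G CG δ`), common rate `δ > 0`, jointly `N`-block covariant, the sum `EE₁ + EE₂` is the ENTRYWISE pair form `P(μα;νβ) + P(να;μβ)` with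
`P` antisymmetric in each index pair — road-P2 F9's `pairFormLS_of_pairForm` ∕ `exists_pairForm_of_word` shape — GIVEN the bond–leg antisymmetry of the FULL
period-`N` face currents of `S` in the two literal shapes of leaf-04 g69's (A)-tower F5 `CurrentSymTower.sym_SpureRecAt` (weighted leg first; its class data
`c + dΨ`, bounded and face-supported at period `Lc`, include the deep indicator `χ` for every `Lc ∣ N`) and `faceSource_unitS_SpureRecAt_add_swap_eq_zero` (free leg
first).  The cell-restricted currents are NOT antisymmetric (memo `CT-THREE-CHANNELS-g68.md` §3c: the cell face field is not pure gauge); each antisymmetry is read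
on the form in which THAT pair's current is the full one, and Part 42∕43's cell transfer identifies the two forms.  leaf-06 g53's J2
`ExchangeESectorLatticeWords.exists_pairForm_eeWords` is the period-`Lc`, E-sector, lattice-word instance of the same junction.
* §1 **`word_right_antisymm`** (per left bond `v`, any integer modulus): `Σ'_t χ(t_e)·Σ'_{(y,w)} χ(y_b)χ(w_c)·((S a v ∘ G) ∘ S e t)(y,w)(inl b)(inl c) = −(the same
  with (c,e) exchanged)` ⟸ hR (free-leg-first antisymmetry) — by Part 42 `nested_eq_facePairing` the right current `Σ'_w χ(w_·)·Σ'_t χ(t_·)·S · t z w f (inl ·)` is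
  exposed VERBATIM.
* §2 **`word_left_antisymm`** (per right bond `s`) ⟸ hL (weighted-leg-first antisymmetry) — by Part 44a `FaceWordLeftExposure.word_left_exposure` the LEFT current
  `Σ'_y χ(y_b)·Σ'_v χ(v_a)·S a v y x (inl b) f` of the word with the cell on the RIGHT bond is exposed VERBATIM.
* §3 `sum_box_tsum_eeWord_swap` — Part 43 §2 generic in `S`, `G`, `N`: the cell restriction of the face pairing sits on either bond.
* §4 **`eeWords_eq_pairForm`**: `∃ P antisym², ∀ μ ν α β, EE₁(μν;αβ) + EE₂(μν;αβ) = P μ α ν β + P ν α μ β` (witness `P a b c e := EE₁(a,c;b,e)`).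
* §5 **`pairFormLS_eeWords`**: for every scalar `t`, `∃ R antisym², LS(t·(EE₁+EE₂)) = R κκ₁κ′κ₂ + R κ′κ₁κκ₂ + (R κκ₂κ′κ₁ + R κ′κ₂κκ₁)` — the `∃ T antisym²` socket shape
  of `pairFormLS_tower₂`'s `hstep` ∕ road-P2 g50's `towerStepDeep_of_forcingPairForm` (`R = 2tP`, F9 `pairFormLS_of_pairForm`).
Asserts NO value of any current, pairing or table; the two antisymmetries are HYPOTHESES (F5 is staged, not in the tree); discharges NOTHING of (C)_{≥1} ∕ `hstep` ∕
`hSrc` ∕ `hSrcX` ∕ (G14) ∕ (Q-L) ∕ (hW, hWall); NEVER «G-an2-4 closed» as (CONV-C); NOT D1, NOT `BetaPertH`, NOT continuum, NOT Clay.  2026-08-24; no existing file touched.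
-/

noncomputable section

open Finset
open scoped BigOperators
open Literature.MathematicalPhysics.QuantumFieldTheory
open Literature.MathematicalPhysics.QuantumFieldTheory.Balaban1983to89
open Literature.MathematicalPhysics.QuantumFieldTheory.Balaban1983to89.Beta
open B12Sec2to5 (l1 l1_nonneg)
open ExpKernelCalculus (Site MKer Decays BiLoc shiftK comp comp_shiftK biLoc_comp_biLoc Zl Zl_pos Zl_nonneg summable_exp_shift
  summable_exp_shift' tsum_exp_shift')
open OneStepResolventKernel (Fib LocStencil biLoc_mono)
open AffineAveraging (box toSite)
open BalabanStepJetsSucc (biLoc_comp_right)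
open Summit.QuantumFields.BalabanUV.Beta.GAN24.PairingCellTransfer (sum_box_tsum_swap_of_cov faceMask_add_zsmul abs_faceMask_le abs_tsum_facePair_le
  tsum_facePair_shiftK nested_eq_facePairing)
open Summit.QuantumFields.BalabanUV.Beta.GAN24.CombChargeAntisymPairForm (pairFormLS_of_pairForm)
open Summit.QuantumFields.BalabanUV.Beta.GAN24.FaceWordLeftExposure (word_left_exposure)

namespace Summit.QuantumFields.BalabanUV.Beta.GAN24.FacePairingPairForm

variable {d : ℕ}

section PerBond

variable {S : Fin (d + 1) → Site (d + 1) → MKer (d + 1) (Fib d)} {G : MKer (d + 1) (Fib d)} {Cs CG δ : ℝ}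

/-! ## §1 The word is odd under the exchange of the RIGHT current's bond and leg directions (cell or not on the left bond) -/

/-- NOT IN PRINT; OUR BOOKKEEPING.  **RIGHT ANTISYMMETRY OF THE FACE WORD, PER LEFT BOND** (local stencil family `S`, decaying `G`, common rate `δ > 0`, any
integer modulus `N`, any left bond `v`): if the FULL face currents of `S` are bond–leg antisymmetric in the free-leg-first placement (`hR`, the literal shape of
leaf-04 F5 `faceSource_unitS_SpureRecAt_add_swap_eq_zero` with indicator weights), then
`Σ'_t χ(t_e)·Σ'_{(y,w)} χ(y_b)χ(w_c)·((S a v ∘ G) ∘ S e t)(y,w)(inl b)(inl c) = −Σ'_t χ(t_c)·Σ'_{(y,w)} χ(y_b)χ(w_e)·((S a v ∘ G) ∘ S c t)(y,w)(inl b)(inl e)`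
(both sides are Part 42's nested words, in which the right current appears verbatim). -/
theorem word_right_antisymm (hS : LocStencil S Cs δ) (hG : Decays G CG δ) (hδ : 0 < δ) (N : ℤ)
    (hR : ∀ (μ ν : Fin (d + 1)) (s : Site (d + 1)) (f : Fib d),
      (∑' s' : Site (d + 1), (if s' ν % N = N - 1 then (1 : ℝ) else 0) *
          ∑' t' : Site (d + 1), (if t' μ % N = N - 1 then (1 : ℝ) else 0) * S μ t' s s' f (Sum.inl ν)) +
        (∑' s' : Site (d + 1), (if s' μ % N = N - 1 then (1 : ℝ) else 0) *
          ∑' t' : Site (d + 1), (if t' ν % N = N - 1 then (1 : ℝ) else 0) * S ν t' s s' f (Sum.inl μ)) = 0)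
    (a b c e : Fin (d + 1)) (v : Site (d + 1)) :
    ∑' t : Site (d + 1), (if t e % N = N - 1 then (1 : ℝ) else 0) *
        ∑' yw : Site (d + 1) × Site (d + 1), (if yw.1 b % N = N - 1 then (1 : ℝ) else 0) * (if yw.2 c % N = N - 1 then (1 : ℝ) else 0) *
          comp (comp (S a v) G) (S e t) yw.1 yw.2 (Sum.inl b) (Sum.inl c)
      = -(∑' t : Site (d + 1), (if t c % N = N - 1 then (1 : ℝ) else 0) *
        ∑' yw : Site (d + 1) × Site (d + 1), (if yw.1 b % N = N - 1 then (1 : ℝ) else 0) * (if yw.2 e % N = N - 1 then (1 : ℝ) else 0) *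
          comp (comp (S a v) G) (S c t) yw.1 yw.2 (Sum.inl b) (Sum.inl e)) := by
  have h1 := nested_eq_facePairing hS hG hδ N a c b e v 1
  have h2 := nested_eq_facePairing hS hG hδ N a e b c v 1
  rw [one_mul] at h1 h2
  rw [← h1, ← h2]
  -- the exposed right current is odd under `(c, e) ↔ (e, c)`
  have hodd : ∀ (z : Site (d + 1)) (f : Fib d),
      ∑' w : Site (d + 1), (if w c % N = N - 1 then (1 : ℝ) else 0) *
          (1 * ∑' t : Site (d + 1), (if t e % N = N - 1 then (1 : ℝ) else 0) * S e t z w f (Sum.inl c))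
        = -(∑' w : Site (d + 1), (if w e % N = N - 1 then (1 : ℝ) else 0) *
          (1 * ∑' t : Site (d + 1), (if t c % N = N - 1 then (1 : ℝ) else 0) * S c t z w f (Sum.inl e))) := by
    intro z f
    simp only [one_mul]
    exact eq_neg_of_add_eq_zero_left (hR e c z f)
  simp_rw [hodd]
  simp only [mul_neg, tsum_neg, Finset.sum_neg_distrib]

/-! ## §2 The word with the cell on the RIGHT bond is odd under the exchange of the LEFT current's bond and leg directions -/

/-- NOT IN PRINT; OUR BOOKKEEPING.  **LEFT ANTISYMMETRY OF THE FACE WORD WITH THE CELL ON THE RIGHT BOND** (per right bond `s`, any integer modulus): if the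
FULL face currents of `S` are bond–leg antisymmetric in the weighted-leg-first placement (`hL`, the literal shape of leaf-04 F5 `sym_SpureRecAt` with indicator
weights), then `Σ'_v χ(v_b)·Σ'_{(y,w)} χ(y_a)χ(w_e)·((S b v ∘ G) ∘ S c s)(y,w)(inl a)(inl e) = −Σ'_v χ(v_a)·Σ'_{(y,w)} χ(y_b)χ(w_e)·((S a v ∘ G) ∘ S c s)(y,w)(inl b)(inl e)`. -/
theorem word_left_antisymm (hS : LocStencil S Cs δ) (hG : Decays G CG δ) (hδ : 0 < δ) (N : ℤ)
    (hL : ∀ (ν β : Fin (d + 1)) (p : Site (d + 1)) (a' : Fib d),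
      (∑' q : Site (d + 1), (if q β % N = N - 1 then (1 : ℝ) else 0) *
          ∑' u : Site (d + 1), (if u ν % N = N - 1 then (1 : ℝ) else 0) * S ν u q p (Sum.inl β) a') +
        (∑' q : Site (d + 1), (if q ν % N = N - 1 then (1 : ℝ) else 0) *
          ∑' u : Site (d + 1), (if u β % N = N - 1 then (1 : ℝ) else 0) * S β u q p (Sum.inl ν) a') = 0)
    (a b c e : Fin (d + 1)) (s : Site (d + 1)) :
    ∑' v : Site (d + 1), (if v b % N = N - 1 then (1 : ℝ) else 0) *
        ∑' yw : Site (d + 1) × Site (d + 1), (if yw.1 a % N = N - 1 then (1 : ℝ) else 0) * (if yw.2 e % N = N - 1 then (1 : ℝ) else 0) *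
          comp (comp (S b v) G) (S c s) yw.1 yw.2 (Sum.inl a) (Sum.inl e)
      = -(∑' v : Site (d + 1), (if v a % N = N - 1 then (1 : ℝ) else 0) *
        ∑' yw : Site (d + 1) × Site (d + 1), (if yw.1 b % N = N - 1 then (1 : ℝ) else 0) * (if yw.2 e % N = N - 1 then (1 : ℝ) else 0) *
          comp (comp (S a v) G) (S c s) yw.1 yw.2 (Sum.inl b) (Sum.inl e)) := by
  rw [word_left_exposure hS hG hδ N b a c e s, word_left_exposure hS hG hδ N a b c e s]
  have hodd : ∀ (x : Site (d + 1)) (f : Fib d),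
      ∑' y : Site (d + 1), (if y a % N = N - 1 then (1 : ℝ) else 0) *
          ∑' v : Site (d + 1), (if v b % N = N - 1 then (1 : ℝ) else 0) * S b v y x (Sum.inl a) f
        = -(∑' y : Site (d + 1), (if y b % N = N - 1 then (1 : ℝ) else 0) *
          ∑' v : Site (d + 1), (if v a % N = N - 1 then (1 : ℝ) else 0) * S a v y x (Sum.inl b) f) :=
    fun x f => eq_neg_of_add_eq_zero_right (hL a b x f)
  simp_rw [hodd]
  simp only [neg_mul, Finset.sum_neg_distrib, tsum_neg]

/-! ## §3 The cell restriction of the face pairing sits on either bond (Part 43 §2, generic) -/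

/-- [folklore] The triple word `S κ v ∘ G ∘ S κ′ s` is bi-localised at its two bonds with the inner-distance factor (Part 43 `biLoc_tripleWord`, generic;
re-proved here because that module has no olean yet — credit Part 43). -/
private theorem biLoc_triple (hS : LocStencil S Cs δ) (hG : Decays G CG δ) (hδ : 0 < δ) (κ κ' : Fin (d + 1)) (v s : Site (d + 1)) :
    BiLoc (comp (comp (S κ v) G) (S κ' s)) v s
      ((Fintype.card (Fib d) : ℝ) * ((Fintype.card (Fib d) : ℝ) * (Cs * CG) * Zl (d + 1) (δ - δ / 2) * Cs) * Zl (d + 1) (δ / 2 / 2)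
        * Real.exp (-(δ / 2 / 2) * l1 (v - s))) (δ / 2) := by
  have hCs : 0 ≤ Cs := (hS κ v).nonneg (Sum.inl 0)
  have h1 : BiLoc (comp (S κ v) G) v v ((Fintype.card (Fib d) : ℝ) * (Cs * CG) * Zl (d + 1) (δ - δ / 2)) (δ / 2) :=
    biLoc_comp_right (hS κ v) hG (by positivity) (by linarith)
  have h2 : BiLoc (S κ' s) s s Cs (δ / 2) := biLoc_mono (hS κ' s) hCs (by linarith)
  exact biLoc_comp_biLoc h1 h2 (by positivity)

/-- [folklore] Joint block covariance of the triple word (Part 43 `tripleWord_translate`, generic; re-proved, credit Part 43). -/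
private theorem triple_translate {N : ℕ} (hSt : ∀ κ u t, S κ (u + (N : ℤ) • t) = shiftK (-((N : ℤ) • t)) (S κ u))
    (hGt : ∀ t, shiftK (-((N : ℤ) • t)) G = G) (κ κ' : Fin (d + 1)) (v s t : Site (d + 1)) :
    comp (comp (S κ (v + (N : ℤ) • t)) G) (S κ' (s + (N : ℤ) • t)) = shiftK (-((N : ℤ) • t)) (comp (comp (S κ v) G) (S κ' s)) := by
  rw [hSt κ v t, hSt κ' s t]
  conv_lhs => rw [← hGt t]
  rw [comp_shiftK, comp_shiftK]

/-- NOT IN PRINT; OUR BOOKKEEPING.  **THE CELL RESTRICTION OF THE FACE PAIRING SITS ON EITHER BOND** (Part 43 `sum_box_tsum_facePairing_swap`, generic in the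
local stencil family `S`, the decaying kernel `G` — common rate `δ > 0`, jointly `N`-block covariant — and the period `N ≥ 1`): with
`Ψ(v,s) := χ(v_κ)·χ(s_κ′)·Σ'_{(y,w)} χ(y_α)χ(w_β)·((S κ v ∘ G) ∘ S κ′ s)(y,w)(inl α)(inl β)`, `Σ_{rr∈box N} Σ'_s Ψ(toSite rr, s) = Σ_{rr∈box N} Σ'_v Ψ(v, toSite rr)`. -/
theorem sum_box_tsum_eeWord_swap {N : ℕ} [NeZero N] (hS : LocStencil S Cs δ) (hG : Decays G CG δ) (hδ : 0 < δ)
    (hSt : ∀ κ u t, S κ (u + (N : ℤ) • t) = shiftK (-((N : ℤ) • t)) (S κ u)) (hGt : ∀ t, shiftK (-((N : ℤ) • t)) G = G)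
    (κ κ' α β : Fin (d + 1)) :
    ∑ rr ∈ box (d + 1) N, ∑' s : Site (d + 1),
        (if toSite rr κ % (N : ℤ) = (N : ℤ) - 1 then (1 : ℝ) else 0) * (if s κ' % (N : ℤ) = (N : ℤ) - 1 then (1 : ℝ) else 0) *
          ∑' yw : Site (d + 1) × Site (d + 1), (if yw.1 α % (N : ℤ) = (N : ℤ) - 1 then (1 : ℝ) else 0) * (if yw.2 β % (N : ℤ) = (N : ℤ) - 1 then (1 : ℝ) else 0) *
            comp (comp (S κ (toSite rr)) G) (S κ' s) yw.1 yw.2 (Sum.inl α) (Sum.inl β)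
      = ∑ rr ∈ box (d + 1) N, ∑' v : Site (d + 1),
        (if v κ % (N : ℤ) = (N : ℤ) - 1 then (1 : ℝ) else 0) * (if toSite rr κ' % (N : ℤ) = (N : ℤ) - 1 then (1 : ℝ) else 0) *
          ∑' yw : Site (d + 1) × Site (d + 1), (if yw.1 α % (N : ℤ) = (N : ℤ) - 1 then (1 : ℝ) else 0) * (if yw.2 β % (N : ℤ) = (N : ℤ) - 1 then (1 : ℝ) else 0) *
            comp (comp (S κ v) G) (S κ' (toSite rr)) yw.1 yw.2 (Sum.inl α) (Sum.inl β) := by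
  set Ψ : Site (d + 1) → Site (d + 1) → ℝ := fun v s =>
    (if v κ % (N : ℤ) = (N : ℤ) - 1 then (1 : ℝ) else 0) * (if s κ' % (N : ℤ) = (N : ℤ) - 1 then (1 : ℝ) else 0) *
      ∑' yw : Site (d + 1) × Site (d + 1), (if yw.1 α % (N : ℤ) = (N : ℤ) - 1 then (1 : ℝ) else 0) * (if yw.2 β % (N : ℤ) = (N : ℤ) - 1 then (1 : ℝ) else 0) *
        comp (comp (S κ v) G) (S κ' s) yw.1 yw.2 (Sum.inl α) (Sum.inl β) with hΨ
  set K₀ : ℝ := (Fintype.card (Fib d) : ℝ) * ((Fintype.card (Fib d) : ℝ) * (Cs * CG) * Zl (d + 1) (δ - δ / 2) * Cs) * Zl (d + 1) (δ / 2 / 2) with hK₀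
  have hbound : ∀ v s, |Ψ v s| ≤ K₀ * (Zl (d + 1) (δ / 2) * Zl (d + 1) (δ / 2)) * Real.exp (-(δ / 2 / 2) * l1 (v - s)) := by
    intro v s
    have hW := biLoc_triple hS hG hδ κ κ' v s
    have h := abs_tsum_facePair_le hW (by positivity) (N : ℤ) α β (Sum.inl α) (Sum.inl β)
    simp only [hΨ]
    rw [abs_mul, abs_mul]
    calc |(if v κ % (N : ℤ) = (N : ℤ) - 1 then (1 : ℝ) else 0)| * |(if s κ' % (N : ℤ) = (N : ℤ) - 1 then (1 : ℝ) else 0)| * _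
        ≤ 1 * 1 * (K₀ * Real.exp (-(δ / 2 / 2) * l1 (v - s)) * (Zl (d + 1) (δ / 2) * Zl (d + 1) (δ / 2))) :=
          mul_le_mul (mul_le_mul (abs_faceMask_le _ v κ) (abs_faceMask_le _ s κ') (abs_nonneg _) zero_le_one) h (abs_nonneg _) (by norm_num)
      _ = K₀ * (Zl (d + 1) (δ / 2) * Zl (d + 1) (δ / 2)) * Real.exp (-(δ / 2 / 2) * l1 (v - s)) := by ring
  have hδ4 : 0 < δ / 2 / 2 := by positivity
  have hGs : ∀ v, Summable fun s => Ψ v s := fun v =>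
    Summable.of_norm_bounded ((summable_exp_shift hδ4 v).mul_left (K₀ * (Zl (d + 1) (δ / 2) * Zl (d + 1) (δ / 2))))
      (fun s => by rw [Real.norm_eq_abs]; exact hbound v s)
  have hGv : ∀ s, Summable fun v => Ψ v s := fun s =>
    Summable.of_norm_bounded ((summable_exp_shift' hδ4 s).mul_left (K₀ * (Zl (d + 1) (δ / 2) * Zl (d + 1) (δ / 2))))
      (fun v => by rw [Real.norm_eq_abs]; exact hbound v s)
  have hGcov : ∀ v s t : Site (d + 1), Ψ (v + (N : ℤ) • t) (s + (N : ℤ) • t) = Ψ v s := by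
    intro v s t
    simp only [hΨ]
    rw [faceMask_add_zsmul N v t κ, faceMask_add_zsmul N s t κ', triple_translate hSt hGt κ κ' v s t,
      tsum_facePair_shiftK N _ t α β (Sum.inl α) (Sum.inl β)]
  exact (sum_box_tsum_swap_of_cov (N := N) hGs hGv hGcov).symm

end PerBond

/-! ## §4 The two words sum to an entrywise antisymmetric-pair form -/

section PairForm

variable {N : ℕ}
variable {S : Fin (d + 1) → Site (d + 1) → MKer (d + 1) (Fib d)} {G : MKer (d + 1) (Fib d)} {Cs CG δ : ℝ}

/-- [folklore] Factoring a mask that is constant in the lattice slot out of the cell word (cell on the LEFT bond). -/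
theorem cellWord_factor_left (χ₁ : (Fin (d + 1) → ℕ) → ℝ) (T : Site (d + 1) → Site (d + 1) → ℝ) (χ₂ : Site (d + 1) → ℝ) :
    ∑ rr ∈ box (d + 1) N, ∑' t : Site (d + 1), χ₁ rr * χ₂ t * T (toSite rr) t
      = ∑ rr ∈ box (d + 1) N, χ₁ rr * ∑' t : Site (d + 1), χ₂ t * T (toSite rr) t := by
  refine Finset.sum_congr rfl fun rr _ => ?_
  rw [← tsum_mul_left]
  exact tsum_congr fun t => by ring

/-- [folklore] The same with the cell on the RIGHT bond. -/
theorem cellWord_factor_right (χ₁ : (Fin (d + 1) → ℕ) → ℝ) (T : Site (d + 1) → Site (d + 1) → ℝ) (χ₂ : Site (d + 1) → ℝ) :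
    ∑ rr ∈ box (d + 1) N, ∑' v : Site (d + 1), χ₂ v * χ₁ rr * T v (toSite rr)
      = ∑ rr ∈ box (d + 1) N, χ₁ rr * ∑' v : Site (d + 1), χ₂ v * T v (toSite rr) := by
  refine Finset.sum_congr rfl fun rr _ => ?_
  rw [← tsum_mul_left]
  exact tsum_congr fun v => by ring

variable [NeZero N]

/-- NOT IN PRINT; OUR BOOKKEEPING.  **THE TWO EXCHANGE ∕ CONTACT FACE WORDS AT ANY PERIOD ARE AN ENTRYWISE PAIR FORM** (`N ≥ 1`; local stencil family `S`
and decaying kernel `G` with common rate `δ > 0`, jointly `N`-block covariant; the FULL period-`N` face currents of `S` bond–leg antisymmetric in leaf-04 F5's two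
literal shapes, `hL` weighted-leg-first, `hR` free-leg-first):
`∃ P` antisymmetric in each index pair, `∀ μ ν α β, EE₁(μ,ν;α,β) + EE₂(μ,ν;α,β) = P μ α ν β + P ν α μ β` (module docstring; witness `P a b c e := EE₁(a,c;b,e)`:
antisymmetry in `(c,e)` by §1 per cell bond, in `(a,b)` by §3 ⨾ §2 ⨾ §3, and `EE₂(μν;αβ) = P ν α μ β` by §3). -/
theorem eeWords_eq_pairForm (hS : LocStencil S Cs δ) (hG : Decays G CG δ) (hδ : 0 < δ)
    (hSt : ∀ κ u t, S κ (u + (N : ℤ) • t) = shiftK (-((N : ℤ) • t)) (S κ u)) (hGt : ∀ t, shiftK (-((N : ℤ) • t)) G = G)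
    (hL : ∀ (ν β : Fin (d + 1)) (p : Site (d + 1)) (a' : Fib d),
      (∑' q : Site (d + 1), (if q β % (N : ℤ) = (N : ℤ) - 1 then (1 : ℝ) else 0) *
          ∑' u : Site (d + 1), (if u ν % (N : ℤ) = (N : ℤ) - 1 then (1 : ℝ) else 0) * S ν u q p (Sum.inl β) a') +
        (∑' q : Site (d + 1), (if q ν % (N : ℤ) = (N : ℤ) - 1 then (1 : ℝ) else 0) *
          ∑' u : Site (d + 1), (if u β % (N : ℤ) = (N : ℤ) - 1 then (1 : ℝ) else 0) * S β u q p (Sum.inl ν) a') = 0)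
    (hR : ∀ (μ ν : Fin (d + 1)) (s : Site (d + 1)) (f : Fib d),
      (∑' s' : Site (d + 1), (if s' ν % (N : ℤ) = (N : ℤ) - 1 then (1 : ℝ) else 0) *
          ∑' t' : Site (d + 1), (if t' μ % (N : ℤ) = (N : ℤ) - 1 then (1 : ℝ) else 0) * S μ t' s s' f (Sum.inl ν)) +
        (∑' s' : Site (d + 1), (if s' μ % (N : ℤ) = (N : ℤ) - 1 then (1 : ℝ) else 0) *
          ∑' t' : Site (d + 1), (if t' ν % (N : ℤ) = (N : ℤ) - 1 then (1 : ℝ) else 0) * S ν t' s s' f (Sum.inl μ)) = 0) :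
    ∃ P : Fin (d + 1) → Fin (d + 1) → Fin (d + 1) → Fin (d + 1) → ℝ,
      (∀ a b c e, P b a c e = -P a b c e) ∧ (∀ a b c e, P a b e c = -P a b c e) ∧
      ∀ μ ν α β : Fin (d + 1),
        (∑ rr ∈ box (d + 1) N, ∑' t : Site (d + 1),
            (if toSite rr μ % (N : ℤ) = (N : ℤ) - 1 then (1 : ℝ) else 0) * (if t ν % (N : ℤ) = (N : ℤ) - 1 then (1 : ℝ) else 0) *
              ∑' yw : Site (d + 1) × Site (d + 1), (if yw.1 α % (N : ℤ) = (N : ℤ) - 1 then (1 : ℝ) else 0) * (if yw.2 β % (N : ℤ) = (N : ℤ) - 1 then (1 : ℝ) else 0) *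
                comp (comp (S μ (toSite rr)) G) (S ν t) yw.1 yw.2 (Sum.inl α) (Sum.inl β)) +
        (∑ rr ∈ box (d + 1) N, ∑' t : Site (d + 1),
            (if toSite rr μ % (N : ℤ) = (N : ℤ) - 1 then (1 : ℝ) else 0) * (if t ν % (N : ℤ) = (N : ℤ) - 1 then (1 : ℝ) else 0) *
              ∑' yw : Site (d + 1) × Site (d + 1), (if yw.1 α % (N : ℤ) = (N : ℤ) - 1 then (1 : ℝ) else 0) * (if yw.2 β % (N : ℤ) = (N : ℤ) - 1 then (1 : ℝ) else 0) *
                comp (comp (S ν t) G) (S μ (toSite rr)) yw.1 yw.2 (Sum.inl α) (Sum.inl β))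
          = P μ α ν β + P ν α μ β := by
  refine ⟨fun a b c e => ∑ rr ∈ box (d + 1) N, ∑' t : Site (d + 1),
      (if toSite rr a % (N : ℤ) = (N : ℤ) - 1 then (1 : ℝ) else 0) * (if t c % (N : ℤ) = (N : ℤ) - 1 then (1 : ℝ) else 0) *
        ∑' yw : Site (d + 1) × Site (d + 1), (if yw.1 b % (N : ℤ) = (N : ℤ) - 1 then (1 : ℝ) else 0) * (if yw.2 e % (N : ℤ) = (N : ℤ) - 1 then (1 : ℝ) else 0) *
          comp (comp (S a (toSite rr)) G) (S c t) yw.1 yw.2 (Sum.inl b) (Sum.inl e), ?_, ?_, ?_⟩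
  · -- antisymmetry in the LEFT pair: move the cell onto the right bond (§3), flip (§2), move it back (§3)
    intro a b c e
    show (∑ rr ∈ box (d + 1) N, ∑' t : Site (d + 1), _) = -(∑ rr ∈ box (d + 1) N, ∑' t : Site (d + 1), _)
    rw [sum_box_tsum_eeWord_swap hS hG hδ hSt hGt b c a e, sum_box_tsum_eeWord_swap hS hG hδ hSt hGt a c b e,
      cellWord_factor_right (N := N) (fun rr => if toSite rr c % (N : ℤ) = (N : ℤ) - 1 then (1 : ℝ) else 0)
        (fun v s => ∑' yw : Site (d + 1) × Site (d + 1), (if yw.1 a % (N : ℤ) = (N : ℤ) - 1 then (1 : ℝ) else 0) *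
          (if yw.2 e % (N : ℤ) = (N : ℤ) - 1 then (1 : ℝ) else 0) * comp (comp (S b v) G) (S c s) yw.1 yw.2 (Sum.inl a) (Sum.inl e))
        (fun v => if v b % (N : ℤ) = (N : ℤ) - 1 then (1 : ℝ) else 0),
      cellWord_factor_right (N := N) (fun rr => if toSite rr c % (N : ℤ) = (N : ℤ) - 1 then (1 : ℝ) else 0)
        (fun v s => ∑' yw : Site (d + 1) × Site (d + 1), (if yw.1 b % (N : ℤ) = (N : ℤ) - 1 then (1 : ℝ) else 0) *
          (if yw.2 e % (N : ℤ) = (N : ℤ) - 1 then (1 : ℝ) else 0) * comp (comp (S a v) G) (S c s) yw.1 yw.2 (Sum.inl b) (Sum.inl e))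
        (fun v => if v a % (N : ℤ) = (N : ℤ) - 1 then (1 : ℝ) else 0),
      ← Finset.sum_neg_distrib]
    refine Finset.sum_congr rfl fun rr _ => ?_
    rw [word_left_antisymm hS hG hδ (N : ℤ) hL a b c e (toSite rr), mul_neg]
  · -- antisymmetry in the RIGHT pair: §1 per cell bond
    intro a b c e
    show (∑ rr ∈ box (d + 1) N, ∑' t : Site (d + 1), _) = -(∑ rr ∈ box (d + 1) N, ∑' t : Site (d + 1), _)
    rw [cellWord_factor_left (N := N) (fun rr => if toSite rr a % (N : ℤ) = (N : ℤ) - 1 then (1 : ℝ) else 0)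
        (fun v t => ∑' yw : Site (d + 1) × Site (d + 1), (if yw.1 b % (N : ℤ) = (N : ℤ) - 1 then (1 : ℝ) else 0) *
          (if yw.2 c % (N : ℤ) = (N : ℤ) - 1 then (1 : ℝ) else 0) * comp (comp (S a v) G) (S e t) yw.1 yw.2 (Sum.inl b) (Sum.inl c))
        (fun t => if t e % (N : ℤ) = (N : ℤ) - 1 then (1 : ℝ) else 0),
      cellWord_factor_left (N := N) (fun rr => if toSite rr a % (N : ℤ) = (N : ℤ) - 1 then (1 : ℝ) else 0)
        (fun v t => ∑' yw : Site (d + 1) × Site (d + 1), (if yw.1 b % (N : ℤ) = (N : ℤ) - 1 then (1 : ℝ) else 0) *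
          (if yw.2 e % (N : ℤ) = (N : ℤ) - 1 then (1 : ℝ) else 0) * comp (comp (S a v) G) (S c t) yw.1 yw.2 (Sum.inl b) (Sum.inl e))
        (fun t => if t c % (N : ℤ) = (N : ℤ) - 1 then (1 : ℝ) else 0),
      ← Finset.sum_neg_distrib]
    refine Finset.sum_congr rfl fun rr _ => ?_
    rw [word_right_antisymm hS hG hδ (N : ℤ) hR a b c e (toSite rr), mul_neg]
  · -- the display: `EE₁(μν;αβ) = P μ α ν β` verbatim, `EE₂(μν;αβ) = P ν α μ β` by §3
    intro μ ν α β
    dsimp only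
    congr 1
    rw [sum_box_tsum_eeWord_swap hS hG hδ hSt hGt ν μ α β]
    refine Finset.sum_congr rfl fun rr _ => tsum_congr fun v => ?_
    ring

/-! ## §5 The `LS` socket shape -/

/-- NOT IN PRINT; OUR BOOKKEEPING.  **THE LEG-AND-BOND SYMMETRISED FACE WORDS ARE A PAIR FORM** — road-P2's socket shape (`PairFormPeriodTower.pairFormLS_tower₂`'s
`∃ T antisym²`, F9's `LS` spelling VERBATIM): for every scalar `t` and every charge `A` DISPLAYED as `A(κ,κ′;κ₁,κ₂) = t·(EE₁(κκ′;κ₁κ₂) + EE₂(κκ′;κ₁κ₂))` (the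
consumer's own literal on the left),
`∃ R antisym², ∀ κ κ′ κ₁ κ₂, A κκ′κ₁κ₂ + A κ′κκ₁κ₂ + (A κκ′κ₂κ₁ + A κ′κκ₂κ₁) = R κκ₁κ′κ₂ + R κ′κ₁κκ₂ + (R κκ₂κ′κ₁ + R κ′κ₂κκ₁)` (`R = 2tP`, §4 ⨾ F9
`pairFormLS_of_pairForm`). -/
theorem pairFormLS_of_eeWords (hS : LocStencil S Cs δ) (hG : Decays G CG δ) (hδ : 0 < δ)
    (hSt : ∀ κ u t, S κ (u + (N : ℤ) • t) = shiftK (-((N : ℤ) • t)) (S κ u)) (hGt : ∀ t, shiftK (-((N : ℤ) • t)) G = G)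
    (hL : ∀ (ν β : Fin (d + 1)) (p : Site (d + 1)) (a' : Fib d),
      (∑' q : Site (d + 1), (if q β % (N : ℤ) = (N : ℤ) - 1 then (1 : ℝ) else 0) *
          ∑' u : Site (d + 1), (if u ν % (N : ℤ) = (N : ℤ) - 1 then (1 : ℝ) else 0) * S ν u q p (Sum.inl β) a') +
        (∑' q : Site (d + 1), (if q ν % (N : ℤ) = (N : ℤ) - 1 then (1 : ℝ) else 0) *
          ∑' u : Site (d + 1), (if u β % (N : ℤ) = (N : ℤ) - 1 then (1 : ℝ) else 0) * S β u q p (Sum.inl ν) a') = 0)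
    (hR : ∀ (μ ν : Fin (d + 1)) (s : Site (d + 1)) (f : Fib d),
      (∑' s' : Site (d + 1), (if s' ν % (N : ℤ) = (N : ℤ) - 1 then (1 : ℝ) else 0) *
          ∑' t' : Site (d + 1), (if t' μ % (N : ℤ) = (N : ℤ) - 1 then (1 : ℝ) else 0) * S μ t' s s' f (Sum.inl ν)) +
        (∑' s' : Site (d + 1), (if s' μ % (N : ℤ) = (N : ℤ) - 1 then (1 : ℝ) else 0) *
          ∑' t' : Site (d + 1), (if t' ν % (N : ℤ) = (N : ℤ) - 1 then (1 : ℝ) else 0) * S ν t' s s' f (Sum.inl μ)) = 0)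
    (t : ℝ) {A : Fin (d + 1) → Fin (d + 1) → Fin (d + 1) → Fin (d + 1) → ℝ}
    (hA : ∀ κ κ' κ₁ κ₂ : Fin (d + 1), A κ κ' κ₁ κ₂ = t *
      ((∑ rr ∈ box (d + 1) N, ∑' s : Site (d + 1),
          (if toSite rr κ % (N : ℤ) = (N : ℤ) - 1 then (1 : ℝ) else 0) * (if s κ' % (N : ℤ) = (N : ℤ) - 1 then (1 : ℝ) else 0) *
            ∑' yw : Site (d + 1) × Site (d + 1), (if yw.1 κ₁ % (N : ℤ) = (N : ℤ) - 1 then (1 : ℝ) else 0) * (if yw.2 κ₂ % (N : ℤ) = (N : ℤ) - 1 then (1 : ℝ) else 0) *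
              comp (comp (S κ (toSite rr)) G) (S κ' s) yw.1 yw.2 (Sum.inl κ₁) (Sum.inl κ₂)) +
        (∑ rr ∈ box (d + 1) N, ∑' s : Site (d + 1),
          (if toSite rr κ % (N : ℤ) = (N : ℤ) - 1 then (1 : ℝ) else 0) * (if s κ' % (N : ℤ) = (N : ℤ) - 1 then (1 : ℝ) else 0) *
            ∑' yw : Site (d + 1) × Site (d + 1), (if yw.1 κ₁ % (N : ℤ) = (N : ℤ) - 1 then (1 : ℝ) else 0) * (if yw.2 κ₂ % (N : ℤ) = (N : ℤ) - 1 then (1 : ℝ) else 0) *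
              comp (comp (S κ' s) G) (S κ (toSite rr)) yw.1 yw.2 (Sum.inl κ₁) (Sum.inl κ₂)))) :
    ∃ R : Fin (d + 1) → Fin (d + 1) → Fin (d + 1) → Fin (d + 1) → ℝ,
      (∀ a b c e, R b a c e = -R a b c e) ∧ (∀ a b c e, R a b e c = -R a b c e) ∧
      ∀ κ κ' κ₁ κ₂ : Fin (d + 1),
        A κ κ' κ₁ κ₂ + A κ' κ κ₁ κ₂ + (A κ κ' κ₂ κ₁ + A κ' κ κ₂ κ₁) = R κ κ₁ κ' κ₂ + R κ' κ₁ κ κ₂ + (R κ κ₂ κ' κ₁ + R κ' κ₂ κ κ₁) := by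
  obtain ⟨P, hP1, hP2, hE⟩ := eeWords_eq_pairForm hS hG hδ hSt hGt hL hR
  refine ⟨fun a b c e => 2 * (t * P a b c e), ?_, ?_, fun κ κ' κ₁ κ₂ => ?_⟩
  · intro a b c e
    show 2 * (t * P b a c e) = -(2 * (t * P a b c e))
    rw [hP1]; ring
  · intro a b c e
    show 2 * (t * P a b e c) = -(2 * (t * P a b c e))
    rw [hP2]; ring
  · have hA' : ∀ κ κ' κ₁ κ₂ : Fin (d + 1), A κ κ' κ₁ κ₂ = t * P κ κ₁ κ' κ₂ + t * P κ' κ₁ κ κ₂ := fun κ κ' κ₁ κ₂ => by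
      rw [hA κ κ' κ₁ κ₂, hE κ κ' κ₁ κ₂, mul_add]
    exact pairFormLS_of_pairForm (P := fun a b c e => t * P a b c e) hA' κ κ' κ₁ κ₂

end PairForm

end Summit.QuantumFields.BalabanUV.Beta.GAN24.FacePairingPairForm

end
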